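import Mathlib
import Summits.Ventures.PercRepro2.Defs
import Summits.Ventures.PercRepro2.Graph
import Summits.Ventures.PercRepro2.OneColourSwitch
import Summits.Ventures.PercRepro2.RegionHubSign
import Summits.Ventures.PercRepro2.SideSwitch
import Summits.Ventures.PercRepro2.SideSwitchFibre
import Summits.Ventures.PercRepro2.SideSwitchComps
import Summits.Ventures.PercRepro2.SideSwitchMono
import Summits.Ventures.PercRepro2.SideSwitchM9
import Summits.Ventures.PercRepro2.M9NoPocketDefs

/-!
# Dead patterns lie below their clean pattern (blind cell PercRepro2, p3 g35, 2026-08-29;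
`proofs/P3-NPHDR.md` §5(b))

The colour preference `σ_pq = [p ~_Y q] − [p ~_W q]` is monotone in the colouring
(`sigma_mono`).  In the no-pocket fibration a DEAD pattern `flipF D ρ` (the edges of `D` at `d`
turned from `Y` to `W`) lies below the same-type representative `ρ`, and the block switch
`assignX x` preserves that order as long as no switched block meets an edge of `D`
(`assignX_flipF_le`): so **a dirty one-sided point has `σ_pq` at most that of the clean point
of its co-fibre** (`sigma_pq_assignX_flipF_le`) — the dead-end merging of the `W`-cluster of `d`
only helps `p ~_W q`.  This is step (b) of the unit-coordinate proof of (RK) per flip-pair on the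
class without a linking free block; the link constancy (step (v)) is still open in the kernel.
Own work; std axioms.
-/

namespace Summit.Ventures.PercRepro2

namespace NoPocket

open Finset Classical RegionHub OneColourSwitch SideSwitch

variable {V : Type*} {E : Type*}

section Mono

variable {ends : E → Sym2 V}

/-- The colour preference of a pair is monotone in the colouring. -/
lemma sigma_mono [Fintype E] [DecidableEq E] {ω ω' : Config E} (h : ω ≤ ω') (a b : V) :
    sigma ends ω a b ≤ sigma ends ω' a b := by
  unfold sigma
  have h1 : (if Conn ends ω a b then (1 : ℤ) else 0) ≤ if Conn ends ω' a b then 1 else 0 :=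
    ite_le_ite_of_imp (conn_mono h)
  have hc : OneColourSwitch.compl ω' ≤ OneColourSwitch.compl ω := by
    intro e
    have := h e
    simp only [OneColourSwitch.compl]
    cases hω : ω e <;> cases hω' : ω' e <;> simp_all
  have h2 : (if Conn ends (OneColourSwitch.compl ω') a b then (1 : ℤ) else 0) ≤
      if Conn ends (OneColourSwitch.compl ω) a b then 1 else 0 :=
    ite_le_ite_of_imp (conn_mono hc)
  omega

/-- Turning `Y` edges to `W` lowers the colouring. -/
lemma flipF_le_of_true {D : Finset E} {ρ : Config E} (hD : ∀ e ∈ D, ρ e = true) :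
    flipF D ρ ≤ ρ := by
  intro e
  by_cases he : e ∈ D
  · rw [flipF_of_mem he, hD e he]
    simp
  · rw [flipF_of_notMem he]

/-- The block switch preserves the order between a dead pattern and its representative when no
switched block meets an edge of `D` and `D` avoids the switched `T`-edges. -/
lemma assignX_flipF_le [Fintype E] [DecidableEq E] {D : Finset E} {ρ : Config E}
    (hD : ∀ e ∈ D, ρ e = true) (x : Finset (Finset V) × Finset E)
    (hoff : ∀ e ∈ D, e ∉ touches ends (↑(unionT x.1) : Set V)) (hx2 : ∀ e ∈ D, e ∉ x.2) :
    assignX ends x (flipF D ρ) ≤ assignX ends x ρ := by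
  intro e
  by_cases he : e ∈ D
  · have ht : e ∉ touches ends (↑(unionT x.1) : Set V) := hoff e he
    have hx : e ∉ x.2 := hx2 e he
    simp only [assignX, flipTouch, flipF, ht, hx, if_false, if_pos he, hD e he]
    simp
  · simp only [assignX, flipTouch, flipF, if_neg he]
    exact le_rfl

/-- **A dirty point is below its clean point**: `σ_pq` of the assignment of a dead pattern is at
most `σ_pq` of the assignment of the same-type representative. -/
theorem sigma_pq_assignX_flipF_le [Fintype E] [DecidableEq E] {D : Finset E}
    {ρ : Config E} (hD : ∀ e ∈ D, ρ e = true) (x : Finset (Finset V) × Finset E)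
    (hoff : ∀ e ∈ D, e ∉ touches ends (↑(unionT x.1) : Set V)) (hx2 : ∀ e ∈ D, e ∉ x.2)
    (p q : V) :
    sigma ends (assignX ends x (flipF D ρ)) p q ≤ sigma ends (assignX ends x ρ) p q :=
  sigma_mono (assignX_flipF_le hD x hoff hx2) p q

end Mono

end NoPocket

end Summit.Ventures.PercRepro2
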